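import Summits.QuantumFields.BalabanUV.T4Continuum.Support.ScalarCovariantLaplacian
import Summits.QuantumFields.BalabanUV.T4Continuum.Support.GaugeTermCoercivity
import Literature.MathematicalPhysics.QuantumFieldTheory.Balaban1983to89.Beta.DeltaACombesThomas
import Literature.MathematicalPhysics.QuantumFieldTheory.Balaban1983to89.Beta.TorusG0Decay

/-!
# T⁴ programme, SUBSTRATE (shared lattice-gauge analysis library) — COERCIVITY OF THE COVARIANT SCALAR AVERAGED OPERATOR
# `S_U = D_RᴴD_R + a′·n^d·Q′(U)ᴴQ′(U)` SURVIVES THE BACKGROUND (`Coercive (γ′/2 − (dα)² − a′τ(2+τ)) S_U`, level- and volume-free), and the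
# CONSTANTS ∕ WEIGHTS of the decay chain (file 1 of `ScalarCovariantCoercive` → `ScalarCovariantCTDefects` → `ScalarCovariantGreenDecay`)

Substrate cell `b2b-balaban-substrate-*` (seat p3: covariant Laplacian ∕ Green decay constants), chain «level-free decay of the covariant
scalar averaged Green function» = `ScalarCovariantCoercive` (file 1) → `ScalarCovariantCTDefects` (file 2) → `ScalarCovariantGreenDecay`
(file 3).  The NE rows consume the off-diagonal decay of Bałaban's background-field propagators as a LOCATED HYPOTHESIS
([Balaban1985BackgroundPropagators] = [B9] Thm 3.1 (3.42) p.397 «|(G′(U)λ)(x)| ≤ B₀(L^jη)²e^{−δ₀d(y,y′)}|λ| … δ₀, B₀ depending on d and L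
only»; Thm 3.15 (3.187) p.432; rows NE2-P3 (P1-ii), NE1′-P2 WALL E-1, NE3 `hT31`), and the tree's covariant Combes–Thomas certificate
`Literature.….B9Thm37GlueTorusCovCT` (pv21, comb model) is NOT level-free (its rate degrades with the block side — recorded in the header of
`Support/SliceCovariantModel`).  The chain proves the level-free statement for the Support-typed ONE-REGION covariant scalar operator
`S_U = scalarOp n M a′ R T = D_RᴴD_R + a′·n^d·Q′(U)ᴴQ′(U)` of `Support/ScalarCovariantLaplacian` (p208899) on `Tor (fine n M) × o` (fine
torus of side `n·M_μ`, `n = L^j = η⁻¹`, colour index `o`; transporters `R_μ(x)` and site transports `T(x)` are DATA).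

THIS FILE (file 1):
 * §1 **coercivity survives the background**.  From the `U = 1` coercivity `Δ′ ≥ γ′` of `ScalarAveragedPropagator.re_form_DeltaPs_ge`
   (`γ′ = gammaPs d a′`, free of `n` and of the torus), lifted to colour by `GaugeTermCoercivity.coercive_kron_one`, and the Gram-perturbation
   lemma `GaugeTermCoercivity.coercive_gram_perturb`: `gammaU d a′ α τ = γ′/2 − (dα)² − a′·τ(2+τ)`; `gram_eq_sandwich`
   (`(B·siteMul T)ᴴ(B·siteMul T) = siteMul(Tᴴ)·(Π′ ⊗ 1)·siteMul T`, `B = √(n^d)·(Q′ ⊗ 1)`, `BᴴB = Π′ ⊗ 1`); `opNorm_gram_sub_le`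
   (`‖(B·siteMul T)ᴴ(B·siteMul T) − BᴴB‖ ≤ τ(2+τ)`); **`coercive_scalarOp`**: `Coercive (gammaU d a′ α τ) (scalarOp n M a′ R T)` whenever
   `‖n(R_μ(x) − 1)‖ ≤ α` (the `connS` hypothesis shape of `ScalarCovariantLaplacianBounds`) and `‖T(x) − 1‖ ≤ τ` (`D_R = ∂ ⊗ 1 + E`,
   `‖E‖ ≤ dα`: `GaugeTermDecomposition.covGrad_eq`, `opNorm_defect_le`); `isUnit_scalarOp`, `opNorm_scalarOp_inv_le` (`‖S_U⁻¹‖ ≤ γ_U⁻¹`)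
   in the small-field regime `γ_U > 0`; `scalarOp_isHermitian`.
 * §2 the **site weight** `siteW ρ₀ (x, α) = ρ₀ x`, the LEVEL-FREE defect budget
   **`Jcov co d a′ α τ κ = co·(d(1+α)κ²e^{κ²/2} + a′(1+τ)²(cosh κ − 1))`** (what file 2 proves bounds the Combes–Thomas row defect of `S_U`
   at the block scale), the explicit admissible rate **`kappaU co d a′ α τ = min 1 (γ_U/(2·co·(2d(1+α) + a′(1+τ)²) + 1))`** with
   `Jcov_le_linear` (`Jcov κ ≤ co·(2d(1+α) + a′(1+τ)²)·κ` on `[0,1]`) and **`Jcov_kappaU_le`** (`Jcov κ_U ≤ γ_U/2`);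
 * §3 the **distance-to-the-source site weight** `rhoS = η·dist_∞(·, T)` on `TorusG0Decay.ldist` ∕ `CombesThomasFormOp.distTo`:
   `ldist_le_of_blockOf_eq` (same block ⇒ sup distance `≤ n − 1`), `rhoS_lipschitz` (`1/n`-Lipschitz along fine bonds, needs `2 ≤ n·M_μ`),
   `rhoS_osc` (block oscillation `≤ 1`).

HONEST FRAMING (T4-DAG p. 1).  MODEL level: one region (no `Λ_j`, no Dirichlet holes), GLOBAL small field (`α`, `τ` are
hypotheses on the data `R`, `T`), finite torus, ℓ²-pairing ∕ matrix-entry norms (no sup-norm∕Hölder (3.43)–(3.45), no derivative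
entries `∇_UG′`, `G′∇_U*` — successors), route = Combes–Thomas (OURS; print's §3 route is the random-walk expansion); constants
OURS and crude.  NOT [B9] Thm 3.1 as printed; nothing printed is a hypothesis; no `def … : Prop` fact; spine 0/9 unchanged; NOT
infinite volume ∕ mass gap ∕ Clay.  HONEST DEPENDENCY: continuum YM on T⁴ ⇐ BetaPertH ∧ nine spine estimates (0/9 proved);
BetaPertH ⇐ (D1) ∧ (D4) ∧ CAP+tail; G-an2-4 gates asym, D1 and NE2/3/4.  ABSOLUTE RULE kept; no `sorry`.
-/

noncomputable section

open scoped BigOperators ComplexConjugate Matrix Matrix.Norms.L2Operator Kronecker ComplexOrder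

namespace Summit.QuantumFields.BalabanUV.T4Continuum.ScalarCovariantCoercive

open Literature.MathematicalPhysics.QuantumFieldTheory.Balaban1983to89.B5Prop11Plancherel (Tor fine unitVec)
open Literature.MathematicalPhysics.QuantumFieldTheory.Balaban1983to89.B5Action121 (GradOp GradOp_conjTranspose_mul_GradOp)
open Literature.MathematicalPhysics.QuantumFieldTheory.Balaban1983to89.B5Block118 (bpt)
open Literature.MathematicalPhysics.QuantumFieldTheory.Balaban1983to89.B5Blocks16 (blockOf bpt_bijective bpt_val)
open Literature.MathematicalPhysics.QuantumFieldTheory.Balaban1983to89.B5Prop11Lower (nsq nsq_nonneg)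
open Literature.MathematicalPhysics.QuantumFieldTheory.Balaban1983to89.B4TorusKernel.MultiPeriod (circAbs_le_abs)
open Literature.MathematicalPhysics.QuantumFieldTheory.Balaban1983to89.Beta.DeltaACombesThomas (sq_mul_cosh_div_sub_one_le)
open Literature.MathematicalPhysics.QuantumFieldTheory.Balaban1983to89.Beta.TorusG0Decay (ldist ldist_self ldist_symm ldist_triangle
  ldist_step_le ldist_le_of_forall one_le)
open Literature.MathematicalPhysics.QuantumFieldTheory.Balaban1983to89.Beta.CombesThomasFormOp (distTo distTo_le le_distTo
  distTo_le_zero_of_mem abs_distTo_sub_le)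
open Summit.QuantumFields.BalabanUV.T4Continuum
open Summit.QuantumFields.BalabanUV.T4Continuum.KroneckerLift
open Summit.QuantumFields.BalabanUV.T4Continuum.BlockMultiplication
open Summit.QuantumFields.BalabanUV.T4Continuum.GaugeTermDecomposition
open Summit.QuantumFields.BalabanUV.T4Continuum.ScalarBlockPoincare (PiS)
open Summit.QuantumFields.BalabanUV.T4Continuum.ScalarAveragedPropagator
open Summit.QuantumFields.BalabanUV.T4Continuum.ScalarCovariantLaplacian
open Summit.QuantumFields.BalabanUV.T4Continuum.CoerciveInverseTower (Coercive isUnit_of_coercive opNorm_inv_le_of_coercive)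
open Summit.QuantumFields.BalabanUV.T4Continuum.GaugeTermCoercivity (coercive_gram_perturb coercive_kron_one)

variable {d : ℕ} {o : Type*} [Fintype o] [DecidableEq o]
variable (n : ℕ) [NeZero n] (M : Fin d → ℕ) [hM : ∀ μ, NeZero (M μ)]

/-! ## §1 Coercivity of `S_U` survives the background; invertibility; Hermitian symmetry -/

section Coercivity

variable {a' : ℝ}

/-- the background coercivity constant **`γ_U = γ′/2 − (dα)² − a′·τ(2+τ)`** (`γ′ = gammaPs d a′` the `U = 1` constant of
`ScalarAveragedPropagator`; `α` the size of the connection `n(R − 1)`, `τ` the size of `T − 1`). [folklore] -/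
def gammaU (d : ℕ) (a' α τ : ℝ) : ℝ := gammaPs d a' / 2 - (d * α) ^ 2 - a' * (τ * (2 + τ))

/-- `‖siteMul T − 1‖ ≤ τ` from `‖T(x) − 1‖ ≤ τ`. [folklore] -/
theorem opNorm_siteMul_sub_one_le {T : Tor (fine n M) → Matrix o o ℂ} {τ : ℝ} (hτ : 0 ≤ τ) (hT : ∀ x, ‖T x - 1‖ ≤ τ) :
    ‖siteMul T - (1 : Matrix (Tor (fine n M) × o) (Tor (fine n M) × o) ℂ)‖ ≤ τ := by
  rw [← siteMul_one (ι := Tor (fine n M)) (o := o), ← siteMul_sub]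
  exact opNorm_siteMul_le _ hτ hT

/-- `‖siteMul T‖ ≤ 1 + τ`. [folklore] -/
theorem opNorm_siteMul_le_one_add {T : Tor (fine n M) → Matrix o o ℂ} {τ : ℝ} (hτ : 0 ≤ τ) (hT : ∀ x, ‖T x - 1‖ ≤ τ) :
    ‖siteMul T‖ ≤ 1 + τ := by
  have h1 : ‖(1 : Matrix (Tor (fine n M) × o) (Tor (fine n M) × o) ℂ)‖ ≤ 1 := by
    rw [Matrix.cstar_norm_def, map_one]; exact ContinuousLinearMap.norm_id_le
  have e : siteMul T = (siteMul T - 1) + 1 := by abel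
  rw [e]
  exact (norm_add_le _ _).trans (add_comm (1 : ℝ) τ ▸ add_le_add (opNorm_siteMul_sub_one_le n M hτ hT) h1)

/-- the normalised mass term as a sandwich of `Π′ ⊗ 1`: `(B·siteMul T)ᴴ(B·siteMul T) = siteMul(Tᴴ)·(Π′ ⊗ 1)·siteMul T`. [folklore] -/
theorem gram_eq_sandwich (T : Tor (fine n M) → Matrix o o ℂ) :
    (Bs o n M * siteMul T)ᴴ * (Bs o n M * siteMul T)
      = siteMul (fun x => (T x)ᴴ) * (PiS n M ⊗ₖ (1 : Matrix o o ℂ)) * siteMul T := by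
  rw [Matrix.conjTranspose_mul, siteMul_conjTranspose, Matrix.mul_assoc, ← Matrix.mul_assoc (Bs o n M)ᴴ, Bs_conjTranspose_mul_Bs,
    Matrix.mul_assoc]

/-- `‖(B·siteMul T)ᴴ(B·siteMul T) − BᴴB‖ ≤ τ(2 + τ)`. [folklore] -/
theorem opNorm_gram_sub_le {T : Tor (fine n M) → Matrix o o ℂ} {τ : ℝ} (hτ : 0 ≤ τ) (hT : ∀ x, ‖T x - 1‖ ≤ τ) :
    ‖(Bs o n M * siteMul T)ᴴ * (Bs o n M * siteMul T) - (Bs o n M)ᴴ * Bs o n M‖ ≤ τ * (2 + τ) := by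
  set S : Matrix (Tor (fine n M) × o) (Tor (fine n M) × o) ℂ := siteMul T with hS
  set P : Matrix (Tor (fine n M) × o) (Tor (fine n M) × o) ℂ := (Bs o n M)ᴴ * Bs o n M with hP
  have hP1 : ‖P‖ ≤ 1 := by
    rw [hP]
    calc ‖(Bs o n M)ᴴ * Bs o n M‖ ≤ ‖(Bs o n M)ᴴ‖ * ‖Bs o n M‖ := Matrix.l2_opNorm_mul _ _
      _ ≤ 1 * 1 := mul_le_mul (by rw [Matrix.l2_opNorm_conjTranspose]; exact opNorm_Bs_le o n M) (opNorm_Bs_le o n M)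
          (norm_nonneg _) zero_le_one
      _ = 1 := one_mul _
  have hS1 : ‖S - 1‖ ≤ τ := opNorm_siteMul_sub_one_le n M hτ hT
  have hSH : ‖Sᴴ - 1‖ ≤ τ := by
    rw [show Sᴴ - 1 = (S - 1)ᴴ by rw [Matrix.conjTranspose_sub, Matrix.conjTranspose_one], Matrix.l2_opNorm_conjTranspose]
    exact hS1
  have hS2 : ‖S‖ ≤ 1 + τ := opNorm_siteMul_le_one_add n M hτ hT
  have e : (Bs o n M * S)ᴴ * (Bs o n M * S) - P = (Sᴴ - 1) * P * S + P * (S - 1) := by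
    rw [Matrix.conjTranspose_mul, hP]
    simp only [Matrix.sub_mul, Matrix.mul_sub, Matrix.one_mul, Matrix.mul_one, Matrix.mul_assoc]
    abel
  rw [e]
  calc ‖(Sᴴ - 1) * P * S + P * (S - 1)‖ ≤ ‖(Sᴴ - 1) * P * S‖ + ‖P * (S - 1)‖ := norm_add_le _ _
    _ ≤ τ * 1 * (1 + τ) + 1 * τ := by
        refine add_le_add ?_ ?_
        · calc ‖(Sᴴ - 1) * P * S‖ ≤ ‖(Sᴴ - 1) * P‖ * ‖S‖ := Matrix.l2_opNorm_mul _ _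
            _ ≤ (‖Sᴴ - 1‖ * ‖P‖) * ‖S‖ := mul_le_mul_of_nonneg_right (Matrix.l2_opNorm_mul _ _) (norm_nonneg _)
            _ ≤ τ * 1 * (1 + τ) := mul_le_mul (mul_le_mul hSH hP1 (norm_nonneg _) hτ) hS2 (norm_nonneg _) (by positivity)
        · calc ‖P * (S - 1)‖ ≤ ‖P‖ * ‖S - 1‖ := Matrix.l2_opNorm_mul _ _
            _ ≤ 1 * τ := mul_le_mul hP1 hS1 (norm_nonneg _) zero_le_one
    _ = τ * (2 + τ) := by ring

/-- `BᴴB = Π′ ⊗ 1` is positive semidefinite (a Gram matrix). [folklore] -/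
theorem gram_free_posSemidef (ha' : 0 ≤ a') :
    ((a' : ℂ) • ((Bs o n M)ᴴ * Bs o n M)).PosSemidef := by
  have h : ((a' : ℂ) • ((Bs o n M)ᴴ * Bs o n M))
      = ((((Real.sqrt a' : ℝ) : ℂ)) • Bs o n M)ᴴ * ((((Real.sqrt a' : ℝ) : ℂ)) • Bs o n M) := by
    rw [Matrix.conjTranspose_smul, Matrix.smul_mul, Matrix.mul_smul, smul_smul, Complex.star_def, Complex.conj_ofReal,
      ← Complex.ofReal_mul, Real.mul_self_sqrt ha']
  rw [h]
  exact Matrix.posSemidef_conjTranspose_mul_self _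

/-- **COERCIVITY OF `S_U`**: `Coercive (γ′/2 − (dα)² − a′τ(2+τ)) (scalarOp n M a′ R T)` whenever `‖n(R_μ(x) − 1)‖ ≤ α` and
`‖T(x) − 1‖ ≤ τ` — from `Δ′ ⊗ 1 = (∂⊗1)ᴴ(∂⊗1) + a′BᴴB` `γ′`-coercive (`re_form_DeltaPs_ge`, lifted by `coercive_kron_one`),
`D_R = ∂ ⊗ 1 + E` with `‖E‖ ≤ dα` (`GaugeTermDecomposition.opNorm_defect_le`) and `‖Y_U − Y_1‖ ≤ a′τ(2+τ)`, by
`GaugeTermCoercivity.coercive_gram_perturb`.  Uniform in `n` and in the torus.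
[cite: Balaban1985BackgroundPropagators, p.395 «Assuming some regularity of the configuration U it can be easily shown that the
operator Δ′_a is positive.» (shape; constants ours)] [folklore] -/
theorem coercive_scalarOp (ha' : 0 < a') {R : Fin d → (Tor (fine n M) → Matrix o o ℂ)} {T : Tor (fine n M) → Matrix o o ℂ}
    {α τ : ℝ} (hα : 0 ≤ α) (hτ : 0 ≤ τ) (hR : ∀ μ x, ‖connS (fine n M) ((n : ℕ) : ℂ) R μ x‖ ≤ α) (hT : ∀ x, ‖T x - 1‖ ≤ τ) :
    Coercive (gammaU d a' α τ) (scalarOp n M a' R T) := by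
  -- the free operator in Gram-plus-positive shape
  have hS₁ : DeltaPs n M a' ⊗ₖ (1 : Matrix o o ℂ)
      = (GradOp (fine n M) ((n : ℕ) : ℂ) ⊗ₖ (1 : Matrix o o ℂ))ᴴ * (GradOp (fine n M) ((n : ℕ) : ℂ) ⊗ₖ (1 : Matrix o o ℂ))
        + (a' : ℂ) • ((Bs o n M)ᴴ * Bs o n M) := by
    rw [kron_conjTranspose, ← kron_mul, GradOp_conjTranspose_mul_GradOp, Bs_conjTranspose_mul_Bs, DeltaPs, Matrix.add_kronecker,
      Matrix.smul_kronecker]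
  -- the background operator in the same shape
  have hSu : scalarOp n M a' R T
      = (GradOp (fine n M) ((n : ℕ) : ℂ) ⊗ₖ (1 : Matrix o o ℂ) + defect (fine n M) ((n : ℕ) : ℂ) R)ᴴ
          * (GradOp (fine n M) ((n : ℕ) : ℂ) ⊗ₖ (1 : Matrix o o ℂ) + defect (fine n M) ((n : ℕ) : ℂ) R)
        + (a' : ℂ) • ((Bs o n M * siteMul T)ᴴ * (Bs o n M * siteMul T)) := by
    rw [scalarOp, ← covGrad_eq, covGrad_conjTranspose_mul_covGrad]
  have hco : Coercive (gammaPs d a') (DeltaPs n M a' ⊗ₖ (1 : Matrix o o ℂ)) :=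
    coercive_kron_one (fun f => re_form_DeltaPs_ge n M ha' f)
  have hW : ‖defect (fine n M) ((n : ℕ) : ℂ) R‖ ≤ d * α := opNorm_defect_le (fine n M) _ hα (fun μ i => hR μ i.1)
  have hy : ‖(a' : ℂ) • ((Bs o n M * siteMul T)ᴴ * (Bs o n M * siteMul T)) - (a' : ℂ) • ((Bs o n M)ᴴ * Bs o n M)‖
      ≤ a' * (τ * (2 + τ)) := by
    rw [← smul_sub, norm_smul, Complex.norm_real, Real.norm_of_nonneg ha'.le]
    exact mul_le_mul_of_nonneg_left (opNorm_gram_sub_le n M hτ hT) ha'.le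
  have h := coercive_gram_perturb hS₁ hSu (gram_free_posSemidef n M ha'.le) hco hW hy
  simpa [gammaU] using h

/-- hence `S_U` is invertible in the small-field regime `γ_U > 0`. [folklore] -/
theorem isUnit_scalarOp (ha' : 0 < a') {R : Fin d → (Tor (fine n M) → Matrix o o ℂ)} {T : Tor (fine n M) → Matrix o o ℂ}
    {α τ : ℝ} (hα : 0 ≤ α) (hτ : 0 ≤ τ) (hR : ∀ μ x, ‖connS (fine n M) ((n : ℕ) : ℂ) R μ x‖ ≤ α) (hT : ∀ x, ‖T x - 1‖ ≤ τ)
    (hγ : 0 < gammaU d a' α τ) : IsUnit (scalarOp n M a' R T) :=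
  isUnit_of_coercive hγ (coercive_scalarOp n M ha' hα hτ hR hT)

/-- and `‖S_U⁻¹‖ ≤ γ_U⁻¹`. [folklore] -/
theorem opNorm_scalarOp_inv_le (ha' : 0 < a') {R : Fin d → (Tor (fine n M) → Matrix o o ℂ)} {T : Tor (fine n M) → Matrix o o ℂ}
    {α τ : ℝ} (hα : 0 ≤ α) (hτ : 0 ≤ τ) (hR : ∀ μ x, ‖connS (fine n M) ((n : ℕ) : ℂ) R μ x‖ ≤ α) (hT : ∀ x, ‖T x - 1‖ ≤ τ)
    (hγ : 0 < gammaU d a' α τ) : ‖(scalarOp n M a' R T)⁻¹‖ ≤ (gammaU d a' α τ)⁻¹ :=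
  opNorm_inv_le_of_coercive hγ (coercive_scalarOp n M ha' hα hτ hR hT)

/-- `S_U` is Hermitian (a sum of Gram matrices with a real weight). [folklore] -/
theorem scalarOp_isHermitian (a' : ℝ) (R : Fin d → (Tor (fine n M) → Matrix o o ℂ)) (T : Tor (fine n M) → Matrix o o ℂ) :
    (scalarOp n M a' R T).IsHermitian := by
  have hL : (covLapS (fine n M) ((n : ℕ) : ℂ) R)ᴴ = covLapS (fine n M) ((n : ℕ) : ℂ) R := by
    rw [covLapS, Matrix.conjTranspose_sum]
    exact Finset.sum_congr rfl fun μ _ => by rw [Matrix.conjTranspose_mul, Matrix.conjTranspose_conjTranspose]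
  unfold Matrix.IsHermitian
  rw [scalarOp, Matrix.conjTranspose_add, hL, Matrix.conjTranspose_smul, Complex.star_def, Complex.conj_ofReal,
    Matrix.conjTranspose_mul, Matrix.conjTranspose_conjTranspose]

end Coercivity

/-! ## §2 The site weight, the level-free defect budget `Jcov`, the explicit rate `kappaU` -/

section Constants

/-- the site weight read on `Tor (fine n M) × o`. [folklore] -/
abbrev siteW (ρ₀ : Tor (fine n M) → ℝ) : Tor (fine n M) × o → ℝ := fun e => ρ₀ e.1

/-- the LEVEL-FREE defect budget **`Jcov co d a′ α τ κ = co·(d(1+α)κ²e^{κ²/2} + a′(1+τ)²(cosh κ − 1))`** (`co = card o`). [folklore] -/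
def Jcov (co : ℕ) (d : ℕ) (a' α τ κ : ℝ) : ℝ :=
  co * (d * (1 + α) * (κ ^ 2 * Real.exp (κ ^ 2 / 2)) + a' * (1 + τ) ^ 2 * (Real.cosh κ - 1))

omit [Fintype o] [DecidableEq o] [NeZero n] hM in
/-- `Jcov ≥ 0`. [folklore] -/
theorem Jcov_nonneg (co d : ℕ) {a' α τ : ℝ} (ha' : 0 ≤ a') (hα : 0 ≤ α) (κ : ℝ) : 0 ≤ Jcov co d a' α τ κ := by
  have : 0 ≤ Real.cosh κ - 1 := by linarith [Real.one_le_cosh κ]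
  unfold Jcov; positivity

omit [Fintype o] [DecidableEq o] [NeZero n] hM in
/-- for `0 ≤ κ ≤ 1`: `Jcov κ ≤ co·(2d(1+α) + a′(1+τ)²)·κ` (`κ²e^{κ²/2} ≤ 2κ`, `cosh κ − 1 ≤ κ`). [folklore] -/
theorem Jcov_le_linear (co d : ℕ) {a' α τ : ℝ} (ha' : 0 ≤ a') (hα : 0 ≤ α) {κ : ℝ} (hκ0 : 0 ≤ κ) (hκ1 : κ ≤ 1) :
    Jcov co d a' α τ κ ≤ co * (2 * d * (1 + α) + a' * (1 + τ) ^ 2) * κ := by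
  -- `e^{κ²/2} ≤ e^{1/2} ≤ 2`
  have hexp : Real.exp (κ ^ 2 / 2) ≤ 2 := by
    have h1 : κ ^ 2 / 2 ≤ 1 / 2 := by nlinarith
    calc Real.exp (κ ^ 2 / 2) ≤ Real.exp (1 / 2) := Real.exp_le_exp.mpr h1
      _ ≤ 2 := by
          have := Real.exp_one_lt_d9
          have h2 : Real.exp (1 / 2) ^ 2 = Real.exp 1 := by rw [← Real.exp_nat_mul]; norm_num
          nlinarith [Real.exp_pos (1 / 2 : ℝ)]
  have hA : κ ^ 2 * Real.exp (κ ^ 2 / 2) ≤ 2 * κ := by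
    calc κ ^ 2 * Real.exp (κ ^ 2 / 2) ≤ κ ^ 2 * 2 := mul_le_mul_of_nonneg_left hexp (sq_nonneg κ)
      _ = (κ * 2) * κ := by ring
      _ ≤ (1 * 2) * κ := mul_le_mul_of_nonneg_right (mul_le_mul_of_nonneg_right hκ1 zero_le_two) hκ0
      _ = 2 * κ := by ring
  -- `cosh κ − 1 ≤ (κ²/2)e^{κ²/2} ≤ κ`
  have hB : Real.cosh κ - 1 ≤ κ := by
    have h := sq_mul_cosh_div_sub_one_le (n := 1) κ le_rfl
    simp only [Nat.cast_one, one_pow, one_mul, div_one] at h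
    calc Real.cosh κ - 1 ≤ κ ^ 2 / 2 * Real.exp (κ ^ 2 / 2) := h
      _ = (κ ^ 2 * Real.exp (κ ^ 2 / 2)) / 2 := by ring
      _ ≤ (2 * κ) / 2 := by gcongr
      _ = κ := by ring
  unfold Jcov
  rw [show (co : ℝ) * (2 * d * (1 + α) + a' * (1 + τ) ^ 2) * κ = co * (d * (1 + α) * (2 * κ) + a' * (1 + τ) ^ 2 * κ) by ring]
  refine mul_le_mul_of_nonneg_left (add_le_add ?_ ?_) (Nat.cast_nonneg _)
  · exact mul_le_mul_of_nonneg_left hA (by positivity)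
  · exact mul_le_mul_of_nonneg_left hB (by positivity)

/-- the EXPLICIT admissible rate **`κ_U = min 1 (γ_U/(2·co·(2d(1+α) + a′(1+τ)²) + 1))`** (positive whenever `γ_U > 0`). [folklore] -/
def kappaU (co d : ℕ) (a' α τ : ℝ) : ℝ :=
  min 1 (gammaU d a' α τ / (2 * (co * (2 * d * (1 + α) + a' * (1 + τ) ^ 2)) + 1))

omit [Fintype o] [DecidableEq o] [NeZero n] hM in
/-- `0 < κ_U` when `γ_U > 0`. [folklore] -/
theorem kappaU_pos (co d : ℕ) {a' α τ : ℝ} (ha' : 0 ≤ a') (hα : 0 ≤ α) (hγ : 0 < gammaU d a' α τ) : 0 < kappaU co d a' α τ := by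
  unfold kappaU
  refine lt_min zero_lt_one (div_pos hγ ?_)
  positivity

omit [Fintype o] [DecidableEq o] [NeZero n] hM in
/-- `κ_U ≤ 1` and `0 ≤ κ_U`. [folklore] -/
theorem kappaU_nonneg_le_one (co d : ℕ) {a' α τ : ℝ} (ha' : 0 ≤ a') (hα : 0 ≤ α) (hγ : 0 < gammaU d a' α τ) :
    0 ≤ kappaU co d a' α τ ∧ kappaU co d a' α τ ≤ 1 :=
  ⟨(kappaU_pos co d ha' hα hγ).le, min_le_left _ _⟩

omit [Fintype o] [DecidableEq o] [NeZero n] hM in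
/-- **the rate is admissible**: `Jcov κ_U ≤ γ_U/2`. [folklore] -/
theorem Jcov_kappaU_le (co d : ℕ) {a' α τ : ℝ} (ha' : 0 ≤ a') (hα : 0 ≤ α) (hγ : 0 < gammaU d a' α τ) :
    Jcov co d a' α τ (kappaU co d a' α τ) ≤ gammaU d a' α τ / 2 := by
  set A : ℝ := co * (2 * d * (1 + α) + a' * (1 + τ) ^ 2) with hA
  have hA0 : 0 ≤ A := by positivity
  have hk := kappaU_nonneg_le_one co d ha' hα hγ
  refine (Jcov_le_linear co d ha' hα hk.1 hk.2).trans ?_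
  rw [← hA]
  have hle : kappaU co d a' α τ ≤ gammaU d a' α τ / (2 * A + 1) := min_le_right _ _
  calc A * kappaU co d a' α τ ≤ A * (gammaU d a' α τ / (2 * A + 1)) := mul_le_mul_of_nonneg_left hle hA0
    _ = gammaU d a' α τ * (A / (2 * A + 1)) := by ring
    _ ≤ gammaU d a' α τ * (1 / 2) := by
        refine mul_le_mul_of_nonneg_left ?_ hγ.le
        rw [div_le_iff₀ (by positivity)]; linarith
    _ = gammaU d a' α τ / 2 := by ring

end Constants

/-! ## §3 The distance-to-the-source site weight -/

section Weight

/-- two fine sites of the same block are at sup distance `≤ n − 1`. [folklore] -/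
theorem ldist_le_of_blockOf_eq {x x' : Tor (fine n M)} (h : blockOf n M x = blockOf n M x') :
    ldist (fine n M) x x' ≤ ((n - 1 : ℕ) : ℝ) := by
  set e := Equiv.ofBijective _ (bpt_bijective n M) with he
  have hx : x = bpt n M (e.symm x).1 (e.symm x).2 := (e.apply_symm_apply x).symm
  have hx' : x' = bpt n M (e.symm x').1 (e.symm x').2 := (e.apply_symm_apply x').symm
  have hb : (e.symm x).1 = (e.symm x').1 := h
  refine ldist_le_of_forall _ fun i => ?_
  rw [hx, hx', bpt_val, bpt_val, ← hb]
  refine (circAbs_le_abs (one_le _ i) _).trans ?_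
  push_cast
  rw [show ((n : ℤ)) * (((e.symm x).1 i).val : ℤ) + (((e.symm x).2 i : ℕ) : ℤ)
      - ((n : ℤ) * (((e.symm x).1 i).val : ℤ) + (((e.symm x').2 i : ℕ) : ℤ)) = (((e.symm x).2 i : ℕ) : ℤ) - (((e.symm x').2 i : ℕ) : ℤ) by ring]
  have h1 := ((e.symm x).2 i).is_lt
  have h2 := ((e.symm x').2 i).is_lt
  have hn1 : 1 ≤ n := Nat.one_le_iff_ne_zero.mpr (NeZero.ne n)
  rw [abs_le]; constructor <;> omega

/-- the distance-to-the-source site weight `ρ_T = η·dist_∞(·, T)`, `η = 1/n`. [folklore] -/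
def rhoS (T : Finset (Tor (fine n M))) (hT : T.Nonempty) (x : Tor (fine n M)) : ℝ :=
  (1 / (n : ℝ)) * distTo (ldist (fine n M)) T hT x

/-- `ρ_T` is `1/n`-Lipschitz along fine bonds (needs `2 ≤ n·M_μ`: no one-point torus direction). [folklore] -/
theorem rhoS_lipschitz (h2 : ∀ μ, 2 ≤ fine n M μ) (T : Finset (Tor (fine n M))) (hT : T.Nonempty) (x : Tor (fine n M)) (ν : Fin d) :
    |rhoS n M T hT (x + unitVec (fine n M) ν) - rhoS n M T hT x| ≤ 1 / n := by
  have hn0 : (0 : ℝ) < n := by exact_mod_cast Nat.pos_of_ne_zero (NeZero.ne n)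
  rw [rhoS, rhoS, ← mul_sub, abs_mul, abs_of_pos (by positivity : (0 : ℝ) < 1 / n)]
  refine mul_le_of_le_one_right (by positivity) ?_
  have h := abs_distTo_sub_le (ldist (fine n M)) (ldist_symm _) (ldist_triangle _) T hT (x + unitVec (fine n M) ν) x
  have h1 : ldist (fine n M) (x + unitVec (fine n M) ν) x ≤ 1 := by exact_mod_cast ldist_step_le (fine n M) h2 x ν
  exact h.trans h1

/-- `ρ_T` oscillates by `≤ 1` on blocks. [folklore] -/
theorem rhoS_osc (T : Finset (Tor (fine n M))) (hT : T.Nonempty) (x x' : Tor (fine n M)) (h : blockOf n M x = blockOf n M x') :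
    |rhoS n M T hT x - rhoS n M T hT x'| ≤ 1 := by
  have hn0 : (0 : ℝ) < n := by exact_mod_cast Nat.pos_of_ne_zero (NeZero.ne n)
  rw [rhoS, rhoS, ← mul_sub, abs_mul, abs_of_pos (by positivity : (0 : ℝ) < 1 / n)]
  have hd := abs_distTo_sub_le (ldist (fine n M)) (ldist_symm _) (ldist_triangle _) T hT x x'
  have hb : ldist (fine n M) x x' ≤ ((n - 1 : ℕ) : ℝ) := ldist_le_of_blockOf_eq n M h
  have hb' : (((n - 1 : ℕ) : ℝ)) ≤ n := by exact_mod_cast Nat.sub_le n 1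
  calc 1 / (n : ℝ) * |distTo (ldist (fine n M)) T hT x - distTo (ldist (fine n M)) T hT x'| ≤ 1 / n * n :=
        mul_le_mul_of_nonneg_left ((hd.trans hb).trans hb') (by positivity)
    _ = 1 := by field_simp

end Weight

end Summit.QuantumFields.BalabanUV.T4Continuum.ScalarCovariantCoercive

end
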